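import Mathlib
import HarnessLib
import Literature.Analysis.FluidPDE.VorticityCalculus
import Literature.Analysis.FluidPDE.BarkerPrange2020VorticityAlignmentTypeIHolds
import Literature.Analysis.FluidPDE.KNSSWindowLipschitz
import Summits.NavierStokesRegularity.NavierStokesRegularity.Theorems.PoloidalWindowDoorPoloidalWindowRigidityWindow
import Summits.NavierStokesRegularity.NavierStokesRegularity.Theorems.SqueezeCycleExtremalElementExistsRegularity

/-!
# Route `PoloidalWindowDoor`, crux `PoloidalWindowRigidity` (K2, stmt-NavierStokesRegularity-19708) — LINE 21 «hot_hull» (ns-idea-8): CLASS-UNIFORM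
# vorticity bounds and SLAB-UNIFORM convergence (helper S3 of H6 `LeafRecurrence`)

Cell ns-regularity-ideate, seat ns-poloidal-K2-p2 g14 (K2 stub-worker hand, H6 under DIRECTOR-NS #288).  Two consequences of the tree's CLASS-UNIFORM
KNSS bounds `…Theorems.exists_norm_iteratedFDeriv_le_of_typeI` / `exists_lipschitz_time_of_typeI` (KNSS 2009 (4.10)/(4.11): at fixed Type-I constant
`C`, all `x`-derivatives of a slice and their time-Lipschitz moduli are bounded on windows `[a + δ, b)` uniformly over the class):

* `exists_uniform_curl_bounds` — ONE pair `(B, K)` depending only on `C` with `‖ω_u(−1,·)‖ ≤ B` and `ω_u(−1,·)` `K`-Lipschitz for EVERY profile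
  `u` of the class (the sliding flow of H6 moves inside one class, so its leaves have uniformly bounded speed — the input of the Grönwall step);
* `tendstoUniformlyOn_slab` — for class profiles `u j`, `U` (same `C`), POINTWISE convergence `u j t x → U t x` on the open slab already gives UNIFORM
  convergence on every compact slab `[−R, −R⁻¹] × B̄_R` (finite `δ`-net of the compact slab + the class-uniform joint Lipschitz modulus
  `L|t − s| + K₁‖x − y‖`).  This is the topology in which H6's `(ε, R)`-returns are stated.

WHAT THIS IS NOT: not a claim about Navier–Stokes regularity — a-priori-bound bookkeeping for a support of a PASSed research decomposition of ⟨19708⟩'s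
residues (bears_on LADDER-NS N0, rung N0-LocalTubeDoorPoloidal); research cells OPEN; crux 19708 / item 20428 OPEN; NS regularity NOT proved.
-/

noncomputable section

-- the summit and its single sub-problem share the name (CONVENTIONS §1), as in every Theorems file
set_option linter.dupNamespace false

namespace Summit.NavierStokesRegularity.NavierStokesRegularity.Theorems.PoloidalWindowDoorPoloidalWindowRigidityHotHullSlabUniform

open Set Function Filter Topology Metric
open scoped InnerProductSpace RealInnerProductSpace NNReal
open Literature.Analysis Literature.Analysis.FluidPDE Literature.Analysis.UnboundedOperators
open Summit.NavierStokesRegularity.NavierStokesRegularity.Theorems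

/-- **Class-uniform vorticity bounds at time `−1`.**  One bound and one Lipschitz constant for the vorticity slice `curl (u (−1))` of every profile of
the Type-I ancient mild class with constant `C`. -/
theorem exists_uniform_curl_bounds (C : ℝ) :
    ∃ (B : ℝ) (K : ℝ≥0), ∀ ⦃u : ℝ → EuclideanSpace ℝ (Fin 3) → EuclideanSpace ℝ (Fin 3)⦄,
      HasTypeITimeDecay C u → ContinuousOn (uncurry u) (Iio (0 : ℝ) ×ˢ univ) →
      (∀ s t : ℝ, s < t → t < 0 → ∀ x, u t x = heatExtension (u s) (t - s) x - oseenDuhamel 1 s u u t x) →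
      (∀ t < 0, VectorCalculus.IsDivFree (u t)) →
      (∀ x, ‖curl (u (-1)) x‖ ≤ B) ∧ LipschitzWith K (curl (u (-1))) := by
  obtain ⟨K₁, hK₁⟩ := exists_norm_iteratedFDeriv_le_of_typeI C 1 (a := -2) (b := -1 / 2) (δ := 1 / 2)
    (by norm_num) (by norm_num) (by norm_num)
  obtain ⟨K₂, hK₂⟩ := exists_norm_iteratedFDeriv_le_of_typeI C 2 (a := -2) (b := -1 / 2) (δ := 1 / 2)
    (by norm_num) (by norm_num) (by norm_num)
  refine ⟨‖curlCLM‖ * K₁, ‖curlCLM‖₊ * K₂.toNNReal, fun u hrate hcont hmild hdiv => ?_⟩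
  have hA : IsTypeIAncientMild C u := PoloidalWindowDoorPoloidalWindowRigidityWindow.isTypeIAncientMild_of_class hrate hcont hmild hdiv
  have hw : ∀ t < 0, IsWeaklyDivFree (u t) := fun t ht => hA.isWeaklyDivFree ht
  have hmem : (-1 : ℝ) ∈ Ico (-2 + 1 / 2 : ℝ) (-1 / 2) := ⟨by norm_num, by norm_num⟩
  have h2 : ContDiff ℝ 2 (u (-1)) := (hA.analyticOnNhd_slice_univ (by norm_num)).contDiff
  have hD1 : ∀ x, ‖fderiv ℝ (u (-1)) x‖ ≤ K₁ := fun x => by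
    rw [← norm_iteratedFDeriv_one (𝕜 := ℝ)]
    exact hK₁ hcont hw hmild hrate (-1) hmem x
  have hD2 : ∀ x, ‖fderiv ℝ (fderiv ℝ (u (-1))) x‖ ≤ K₂ := fun x => by
    rw [← norm_iteratedFDeriv_one (𝕜 := ℝ), norm_iteratedFDeriv_fderiv]
    exact hK₂ hcont hw hmild hrate (-1) hmem x
  have hdd : Differentiable ℝ (fderiv ℝ (u (-1))) := (h2.fderiv_right (m := 1) (by norm_num)).differentiable (by norm_num)
  have hLipD : LipschitzWith K₂.toNNReal (fderiv ℝ (u (-1))) := by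
    refine lipschitzWith_of_nnnorm_fderiv_le hdd fun x => ?_
    rw [← NNReal.coe_le_coe, coe_nnnorm]
    exact (hD2 x).trans (Real.le_coe_toNNReal _)
  refine ⟨fun x => ?_, ?_⟩
  · rw [curl_eq_curlCLM]
    exact (curlCLM.le_opNorm _).trans (mul_le_mul_of_nonneg_left (hD1 x) (norm_nonneg _))
  · rw [curl_eq_curlCLM_comp]
    exact curlCLM.lipschitz.comp hLipD

/-- **Class-uniform joint Lipschitz modulus on a compact slab.**  For `R ≥ 1` there is `M ≥ 0` (depending only on `C` and `R`) with
`‖u t x − u s y‖ ≤ M (|t − s| + ‖x − y‖)` for all `(t, x), (s, y) ∈ [−R, −R⁻¹] × ℝ³` and every class profile `u`. -/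
theorem exists_uniform_slab_modulus (C : ℝ) {R : ℝ} (hR : 1 ≤ R) :
    ∃ M : ℝ, 0 ≤ M ∧ ∀ ⦃u : ℝ → EuclideanSpace ℝ (Fin 3) → EuclideanSpace ℝ (Fin 3)⦄,
      HasTypeITimeDecay C u → ContinuousOn (uncurry u) (Iio (0 : ℝ) ×ˢ univ) →
      (∀ s t : ℝ, s < t → t < 0 → ∀ x, u t x = heatExtension (u s) (t - s) x - oseenDuhamel 1 s u u t x) →
      (∀ t < 0, VectorCalculus.IsDivFree (u t)) →
      ∀ t ∈ Icc (-R) (-R⁻¹), ∀ s ∈ Icc (-R) (-R⁻¹), ∀ x y : EuclideanSpace ℝ (Fin 3),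
        ‖u t x - u s y‖ ≤ M * (|t - s| + ‖x - y‖) := by
  have hR0 : 0 < R := by linarith
  have hRi : 0 < R⁻¹ := inv_pos.2 hR0
  have hRi1 : R⁻¹ ≤ 1 := inv_le_one_of_one_le₀ hR
  have hab : -R - 1 < -R⁻¹ / 2 := by linarith
  have hb : -R⁻¹ / 2 < 0 := by linarith
  obtain ⟨K₁, hK₁⟩ := exists_norm_iteratedFDeriv_le_of_typeI C 1 (a := -R - 1) (b := -R⁻¹ / 2) (δ := 1) hab hb one_pos
  obtain ⟨L, hL0, hL⟩ := exists_lipschitz_time_of_typeI C 0 (a := -R - 1) (b := -R⁻¹ / 2) (δ := 1) hab hb one_pos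
  have hwin : ∀ t ∈ Icc (-R) (-R⁻¹), t ∈ Ico (-R - 1 + 1) (-R⁻¹ / 2) := fun t ht => ⟨by linarith [ht.1], by linarith [ht.2]⟩
  refine ⟨L + |K₁|, by positivity, fun u hrate hcont hmild hdiv t ht s hs x y => ?_⟩
  have hA : IsTypeIAncientMild C u := PoloidalWindowDoorPoloidalWindowRigidityWindow.isTypeIAncientMild_of_class hrate hcont hmild hdiv
  have hw : ∀ t < 0, IsWeaklyDivFree (u t) := fun t ht => hA.isWeaklyDivFree ht
  -- time step at fixed `x`
  have h1 : ‖u t x - u s x‖ ≤ L * |t - s| := by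
    have h := hL hcont hw hmild hrate s (hwin s hs) t (hwin t ht) x
    rwa [Literature.Analysis.FluidPDE.norm_iteratedFDeriv_zero_sub] at h
  -- space step at fixed `s`
  have hs0 : s < 0 := by linarith [hs.2]
  have hdiff : ∀ z ∈ (univ : Set (EuclideanSpace ℝ (Fin 3))), DifferentiableAt ℝ (u s) z := fun z _ =>
    ((hA.analyticOnNhd_slice_univ hs0) z (mem_univ _)).differentiableAt
  have hbd : ∀ z ∈ (univ : Set (EuclideanSpace ℝ (Fin 3))), ‖fderiv ℝ (u s) z‖ ≤ |K₁| := fun z _ => by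
    rw [← norm_iteratedFDeriv_one (𝕜 := ℝ)]
    exact (hK₁ hcont hw hmild hrate s (hwin s hs) z).trans (le_abs_self _)
  have h2 : ‖u s x - u s y‖ ≤ |K₁| * ‖x - y‖ :=
    convex_univ.norm_image_sub_le_of_norm_fderiv_le hdiff hbd (mem_univ y) (mem_univ x)
  calc ‖u t x - u s y‖ = ‖(u t x - u s x) + (u s x - u s y)‖ := by rw [sub_add_sub_cancel]
    _ ≤ ‖u t x - u s x‖ + ‖u s x - u s y‖ := norm_add_le _ _
    _ ≤ L * |t - s| + |K₁| * ‖x - y‖ := add_le_add h1 h2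
    _ ≤ (L + |K₁|) * (|t - s| + ‖x - y‖) := by
      nlinarith [abs_nonneg (t - s), norm_nonneg (x - y), abs_nonneg K₁, hL0]

/-- **Slab-uniform convergence from pointwise convergence inside the class.**  If `u j`, `U` are class profiles with the same `C` and `u j t x → U t x`
for every `t < 0` and `x`, then `u j → U` uniformly on every compact slab `[−R, −R⁻¹] × B̄_R` (`R ≥ 1`). -/
theorem tendstoUniformlyOn_slab (C : ℝ) {u : ℕ → ℝ → EuclideanSpace ℝ (Fin 3) → EuclideanSpace ℝ (Fin 3)}
    {U : ℝ → EuclideanSpace ℝ (Fin 3) → EuclideanSpace ℝ (Fin 3)}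
    (hrate : ∀ j, HasTypeITimeDecay C (u j)) (hcont : ∀ j, ContinuousOn (uncurry (u j)) (Iio (0 : ℝ) ×ˢ univ))
    (hmild : ∀ j, ∀ s t : ℝ, s < t → t < 0 → ∀ x, u j t x = heatExtension (u j s) (t - s) x - oseenDuhamel 1 s (u j) (u j) t x)
    (hdiv : ∀ j, ∀ t < 0, VectorCalculus.IsDivFree (u j t))
    (hrateU : HasTypeITimeDecay C U) (hcontU : ContinuousOn (uncurry U) (Iio (0 : ℝ) ×ˢ univ))
    (hmildU : ∀ s t : ℝ, s < t → t < 0 → ∀ x, U t x = heatExtension (U s) (t - s) x - oseenDuhamel 1 s U U t x)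
    (hdivU : ∀ t < 0, VectorCalculus.IsDivFree (U t))
    (hconv : ∀ t < 0, ∀ x, Tendsto (fun j => u j t x) atTop (𝓝 (U t x))) {R : ℝ} (hR : 1 ≤ R) :
    TendstoUniformlyOn (fun j (p : ℝ × EuclideanSpace ℝ (Fin 3)) => u j p.1 p.2) (uncurry U) atTop
      (Icc (-R) (-R⁻¹) ×ˢ closedBall (0 : EuclideanSpace ℝ (Fin 3)) R) := by
  have hR0 : 0 < R := by linarith
  have hRi : 0 < R⁻¹ := inv_pos.2 hR0
  obtain ⟨M, hM0, hM⟩ := exists_uniform_slab_modulus C hR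
  set S : Set (ℝ × EuclideanSpace ℝ (Fin 3)) := Icc (-R) (-R⁻¹) ×ˢ closedBall (0 : EuclideanSpace ℝ (Fin 3)) R with hS
  have hSc : IsCompact S := isCompact_Icc.prod (isCompact_closedBall 0 R)
  rw [Metric.tendstoUniformlyOn_iff]
  intro ε hε
  -- a finite `δ`-net of the slab
  set δ : ℝ := ε / (3 * (2 * M + 1)) with hδ
  have hδ0 : 0 < δ := by positivity
  obtain ⟨T, hTS, hTfin, hcover⟩ := finite_cover_balls_of_compact hSc hδ0
  -- eventually close at every net point
  have hnet : ∀ᶠ j in atTop, ∀ p ∈ T, dist (U p.1 p.2) (u j p.1 p.2) < ε / 3 := by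
    refine (hTfin.eventually_all).2 fun p hp => ?_
    have hp0 : p.1 < 0 := by
      have := (hTS hp).1.2
      linarith
    have h := (Metric.tendsto_nhds.1 (hconv p.1 hp0 p.2)) (ε / 3) (by positivity)
    exact h.mono fun j hj => by rw [dist_comm]; exact hj
  filter_upwards [hnet] with j hj q hq
  obtain ⟨p, hpT, hqp⟩ : ∃ p ∈ T, q ∈ ball p δ := by simpa only [mem_iUnion, exists_prop] using hcover hq
  have hpS : p ∈ S := hTS hpT
  rw [mem_ball, Prod.dist_eq] at hqp
  have hqt : |q.1 - p.1| < δ := lt_of_le_of_lt (by rw [← Real.dist_eq]; exact le_max_left _ _) hqp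
  have hqx : ‖q.2 - p.2‖ < δ := lt_of_le_of_lt (by rw [← dist_eq_norm]; exact le_max_right _ _) hqp
  -- the class-uniform modulus for `U` and for `u j`
  have hU1 : ‖U q.1 q.2 - U p.1 p.2‖ ≤ M * (|q.1 - p.1| + ‖q.2 - p.2‖) :=
    hM hrateU hcontU hmildU hdivU q.1 hq.1 p.1 hpS.1 q.2 p.2
  have hu1 : ‖u j q.1 q.2 - u j p.1 p.2‖ ≤ M * (|q.1 - p.1| + ‖q.2 - p.2‖) :=
    hM (hrate j) (hcont j) (hmild j) (hdiv j) q.1 hq.1 p.1 hpS.1 q.2 p.2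
  have hmid := hj p hpT
  have hsmall : M * (|q.1 - p.1| + ‖q.2 - p.2‖) ≤ M * (2 * δ) := by
    nlinarith [hM0, hqt.le, hqx.le]
  have hMδ : M * (2 * δ) ≤ ε / 3 := by
    have h3 : (0 : ℝ) < 2 * M + 1 := by positivity
    have h3' : (2 * M + 1) ≠ 0 := h3.ne'
    have e : M * (2 * δ) = (ε / 3) * (2 * M / (2 * M + 1)) := by
      rw [hδ]
      field_simp
    rw [e]
    exact mul_le_of_le_one_right (by positivity) ((div_le_one h3).2 (by linarith))
  show dist (uncurry U q) (u j q.1 q.2) < ε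
  calc dist (uncurry U q) (u j q.1 q.2) = ‖U q.1 q.2 - u j q.1 q.2‖ := by rw [dist_eq_norm]; rfl
    _ = ‖(U q.1 q.2 - U p.1 p.2) + (U p.1 p.2 - u j p.1 p.2) + (u j p.1 p.2 - u j q.1 q.2)‖ := by
        congr 1; abel
    _ ≤ ‖U q.1 q.2 - U p.1 p.2‖ + ‖U p.1 p.2 - u j p.1 p.2‖ + ‖u j p.1 p.2 - u j q.1 q.2‖ := norm_add₃_le
    _ < ε / 3 + ε / 3 + ε / 3 := by
        have e2 : ‖U p.1 p.2 - u j p.1 p.2‖ < ε / 3 := by rw [← dist_eq_norm]; exact hmid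
        have e3 : ‖u j p.1 p.2 - u j q.1 q.2‖ ≤ ε / 3 := by rw [norm_sub_rev]; exact hu1.trans (hsmall.trans hMδ)
        linarith [hU1.trans (hsmall.trans hMδ)]
    _ = ε := by ring

end Summit.NavierStokesRegularity.NavierStokesRegularity.Theorems.PoloidalWindowDoorPoloidalWindowRigidityHotHullSlabUniform

end
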